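import Summits.Ventures.DiscreteObjects.Hadamard.NormalizerPrimeMain
import Summits.Ventures.DiscreteObjects.Hadamard.Frobenius37Index3Row
import Summits.Ventures.DiscreteObjects.Hadamard.AutomorphismFixedRows668

/-!
# H(668): no block-preserving automorphism normalising an element of order 37 acts on it through the squares or through the
# cubic classes (kernel EXCLUSION of the matrix-level classes `C₃₇ ⋊ C₃₆`, `C₃₇ ⋊ C₁₈`, `C₃₇ ⋊ C₁₂`)

Framing: lottery ticket; floor = certified bounds/negative ranges.

Cell pub-namedobj (venture DiscreteObjects), target (H), hadamard gen 20; the order-37 instance of `NormalizerPrimeMain`.  Let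
`σ = (π, κ, d, e)` be a signed automorphism of a Hadamard matrix of order `668` with `π^37 = κ^37 = 1`, `(π, κ) ≠ (1,1)` (census gen 5,
`hadamard668_fixedRows_37`: `2` fixed rows, `2` fixed columns, `18 + 18` orbits) and `τ = (π', κ', d', e')` a signed automorphism with
`π'π = π^μ π'`, `κ'κ = κ^μ κ'` keeping a free row `x₀` and every free column inside its `σ`-orbit.  Then
(**`hadamard668_order37_normalizer_not_square_generator`**) **no power of `μ` is `≡ 4 (mod 37)`** — i.e. the multiplier group `⟨μ⟩`
does not contain the non-zero squares `C₁₈ = ⟨4⟩` (`ord(μ) ∉ {18, 36}`).  [`normalizing_prime_main`: the `18` `±1` sequences of `x₀`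
have `Σ_y PAF_y(s) = −2` for every `s ≠ 0` and are twisted `μ`-invariant; `μ ≠ 1`, so recentre (`exists_translate_hInvariant_prime`);
`μ`-invariance and `μ^k ≡ 4` give `4`-invariance, so every sequence is a three-valued block (`Frobenius37Row.eq_blk37`) with
`PAF(1) + PAF(2) ∈ {−2, 66, 74}` (`paf_blk37_pm_one_two`, `decide`; `37 ≡ 1 (mod 4)`: the Legendre-type blocks have `PAF = −1 ± 2`
at squares / non-squares); with `t_y = PAF_y(1) + PAF_y(2) + 2 ∈ {0, 68, 76}`, `Σ t_y = −4 + 36 = 32` is impossible.]  Likewise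
(**`hadamard668_order37_normalizer_not_index3_generator`**) **no power of `μ` is `≡ 8 (mod 37)`** (`⟨8⟩` = the index-3 subgroup of
order 12): an `8`-invariant `±1` sequence is a four-valued block (`Frobenius37Index3Row.eq_blk37c`) with
`PAF(1) + PAF(2) + PAF(4) ≥ 7` (`paf_blk37c_pm_124`, `decide` — the `±1` form of gen 4's convexity inequality), while the 18 blocks
must give `Σ = 3·(−2) = −6`.  So `ord(μ mod 37) ∉ {12, 18, 36}`.  Not covered: multiplier groups of order `9` (four classes; gen 5
decided that class at the orbit-matrix level, `Frobenius37Index4`); and no block-permuting version (`S₁₈` has exponent divisible by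
`36`).  EXCLUSION of a symmetry type of a hypothetical object; no order excluded; H(668) untouched; HITS 0/4.  Ours; no `sorry`, no
definitions.
-/

namespace Summit.Ventures.DiscreteObjects.Hadamard

open Finset BigOperators Matrix

open Literature.Combinatorics.Designs.GoethalsSeidel (IsHadamardMatrix)
open Literature.Combinatorics.Designs.LegendrePairs (PAF IsPM TwistedInvariant HInvariant PAF_translate)

variable {ι : Type*} [Fintype ι] [DecidableEq ι]

set_option maxRecDepth 100000 in
set_option maxHeartbeats 4000000 in
/-- the eight `±1` three-valued blocks on `ZMod 37` have `PAF(1) + PAF(2) ∈ {−2, 66, 74}` (kernel evaluation; `1` is a square, `2` a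
non-square) -/
theorem paf_blk37_pm_one_two : ∀ e0 ∈ [(1 : ℤ), -1], ∀ e1 ∈ [(1 : ℤ), -1], ∀ e2 ∈ [(1 : ℤ), -1],
    PAF (blk37 e0 e1 e2) 1 + PAF (blk37 e0 e1 e2) 2 = -2 ∨ PAF (blk37 e0 e1 e2) 1 + PAF (blk37 e0 e1 e2) 2 = 66 ∨
      PAF (blk37 e0 e1 e2) 1 + PAF (blk37 e0 e1 e2) 2 = 74 := by
  decide

/-- `PAF(1) + PAF(2)` of a `4`-invariant `±1` sequence on `ZMod 37` is `−2`, `66` or `74` -/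
theorem paf_one_two_of_inv4_37 (x : ZMod 37 → ℤ) (hx : IsPM x) (hinv : ∀ i, x (4 * i) = x i) :
    PAF x 1 + PAF x 2 = -2 ∨ PAF x 1 + PAF x 2 = 66 ∨ PAF x 1 + PAF x 2 = 74 := by
  have mem : ∀ {e : ℤ}, (e = 1 ∨ e = -1) → e ∈ [(1 : ℤ), -1] := fun h => by rcases h with rfl | rfl <;> simp
  rw [eq_blk37 x hinv]
  exact paf_blk37_pm_one_two (x 0) (mem (hx 0)) (x 1) (mem (hx 1)) (x 2) (mem (hx 2))

set_option maxRecDepth 100000 in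
set_option maxHeartbeats 4000000 in
/-- the sixteen `±1` four-valued blocks on `ZMod 37` (invariant under the cubic-class subgroup `⟨8⟩`) have
`PAF(1) + PAF(2) + PAF(4) ≥ 7` (kernel evaluation; the `±1` form of `blk37c_convex`) -/
theorem paf_blk37c_pm_124 : ∀ e0 ∈ [(1 : ℤ), -1], ∀ e1 ∈ [(1 : ℤ), -1], ∀ e2 ∈ [(1 : ℤ), -1], ∀ e3 ∈ [(1 : ℤ), -1],
    7 ≤ PAF (blk37c e0 e1 e2 e3) 1 + PAF (blk37c e0 e1 e2 e3) 2 + PAF (blk37c e0 e1 e2 e3) 4 := by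
  decide

/-- `PAF(1) + PAF(2) + PAF(4) ≥ 7` for an `8`-invariant `±1` sequence on `ZMod 37` -/
theorem paf_124_of_inv8_37 (x : ZMod 37 → ℤ) (hx : IsPM x) (hinv : ∀ i, x (8 * i) = x i) :
    7 ≤ PAF x 1 + PAF x 2 + PAF x 4 := by
  have mem : ∀ {e : ℤ}, (e = 1 ∨ e = -1) → e ∈ [(1 : ℤ), -1] := fun h => by rcases h with rfl | rfl <;> simp
  rw [eq_blk37c x hinv]
  exact paf_blk37c_pm_124 (x 0) (mem (hx 0)) (x 1) (mem (hx 1)) (x 2) (mem (hx 2)) (x 4) (mem (hx 4))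

omit [Fintype ι] [DecidableEq ι] in
/-- square-invariant `±1` sequences on `ZMod 37` never have `Σ (PAF(1) + PAF(2) + 2) = 32` (each term is `0` or `≥ 68`) -/
lemma sum_family_qr37 {T : Finset ι} (x : ι → ZMod 37 → ℤ) (hpm : ∀ y ∈ T, IsPM (x y))
    (h4 : ∀ y ∈ T, ∀ i, x y (4 * i) = x y i) : ∑ y ∈ T, (PAF (x y) 1 + PAF (x y) 2 + 2) ≠ 32 := by
  have hval : ∀ y ∈ T, PAF (x y) 1 + PAF (x y) 2 + 2 = 0 ∨ 68 ≤ PAF (x y) 1 + PAF (x y) 2 + 2 := by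
    intro y hy
    rcases paf_one_two_of_inv4_37 (x y) (hpm y hy) (h4 y hy) with h | h | h <;> rw [h] <;> norm_num
  have hnn : ∀ y ∈ T, 0 ≤ PAF (x y) 1 + PAF (x y) 2 + 2 := fun y hy => by rcases hval y hy with h | h <;> omega
  by_cases hex : ∃ y ∈ T, PAF (x y) 1 + PAF (x y) 2 + 2 ≠ 0
  · obtain ⟨y₁, hy₁, hne₁⟩ := hex
    have h68 : 68 ≤ PAF (x y₁) 1 + PAF (x y₁) 2 + 2 := by
      rcases hval y₁ hy₁ with h | h
      · exact absurd h hne₁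
      · exact h
    have := Finset.single_le_sum hnn hy₁
    omega
  · push Not at hex
    rw [Finset.sum_eq_zero hex]
    norm_num

section main
variable {H : Matrix ι ι ℤ}

/-- **EXCLUSION (order 37, block-preserving normalisers do not act through the squares).**  `σ = (π, κ, d, e)` a signed automorphism
of an H(668) with `π^37 = κ^37 = 1`, `(π, κ) ≠ (1,1)`; `τ` a signed automorphism with `π'π = π^μ π'`, `κ'κ = κ^μ κ'` keeping the free
row `x₀` and every free column inside its `σ`-orbit; then **no power `μ^k` is `≡ 4 (mod 37)`** (the multiplier group misses the
squares; `ord(μ mod 37) ∉ {18, 36}`). -/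
theorem hadamard668_order37_normalizer_not_square_generator (hH : IsHadamardMatrix H) (hι : Fintype.card ι = 668)
    {π κ π' κ' : Equiv.Perm ι} {d e d' e' : ι → ℤ} (haut : IsSignedAut H π κ d e)
    (hπ : π ^ 37 = 1) (hκ : κ ^ 37 = 1) (hne : π ≠ 1 ∨ κ ≠ 1)
    (haut' : IsSignedAut H π' κ' d' e') {μ : ℕ} (hnπ : π' * π = π ^ μ * π') (hnκ : κ' * κ = κ ^ μ * κ')
    {x₀ : ι} (hx₀ : π x₀ ≠ x₀) (hrow : π' x₀ ∈ orbFin π 37 x₀) (hcols : ∀ y, κ y ≠ y → κ' y ∈ orbFin κ 37 y)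
    (k : ℕ) : (μ : ZMod 37) ^ k ≠ 4 := by
  have h10 : (1 : ZMod 37) ≠ 0 := by decide
  have h20 : (2 : ZMod 37) ≠ 0 := by decide
  have h41 : (4 : ZMod 37) ≠ 1 := by decide
  intro hk4
  have h37 := hadamard668_fixedRows_37 hH hι π κ d e haut hπ hκ hne
  obtain ⟨u, T, x, hu, hTc, hpm, hgs, htw⟩ := normalizing_prime_main (by norm_num : Nat.Prime 37) (by decide : Odd 37)
    hH haut hπ hκ hne haut' hnπ hnκ hx₀ hrow hcols
  have hsplit := Finset.card_filter_add_card_filter_not (s := (univ : Finset ι)) (fun y => κ y = y)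
  rw [h37.2, Finset.card_univ, hι] at hsplit
  have hm : (univ.filter fun y => ¬ κ y = y).card = 666 := by omega
  have hm' : (univ.filter fun y => κ y ≠ y).card = 666 := hm
  rw [hm'] at hTc
  have hT18 : T.card = 18 := by omega
  rw [h37.2] at hgs
  rw [← hu] at hk4
  have hu1 : (u : ZMod 37) ≠ 1 := fun h => h41 (by rw [← hk4, h, one_pow])
  haveI : Fact (Nat.Prime 37) := ⟨by norm_num⟩
  have hrec : ∀ y ∈ T, ∃ δ : ZMod 37, HInvariant (Literature.Combinatorics.Designs.LegendrePairs.translate (x y) δ) u :=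
    fun y hy => exists_translate_hInvariant_prime (x y) u hu1 (htw y hy)
  choose! δ hδ using hrec
  set x' : ι → ZMod 37 → ℤ := fun y => Literature.Combinatorics.Designs.LegendrePairs.translate (x y) (δ y) with hx'
  have hpm' : ∀ y ∈ T, IsPM (x' y) := fun y hy r => hpm y hy _
  -- u-invariance ⇒ u^k = 4 invariance
  have h4' : ∀ y ∈ T, ∀ i, x' y (4 * i) = x' y i := by
    intro y hy
    have hpow : ∀ n : ℕ, ∀ i, x' y ((u : ZMod 37) ^ n * i) = x' y i := by
      intro n; induction n with
      | zero => intro i; simp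
      | succ n ih => intro i; rw [pow_succ, mul_assoc, ih]; exact hδ y hy i
    intro i; rw [← hk4]; exact hpow k i
  have hgs1 : ∑ y ∈ T, PAF (x' y) 1 = -2 := by
    rw [Finset.sum_congr rfl fun y _ => PAF_translate (x y) (δ y) 1]; simpa using hgs 1 h10
  have hgs2 : ∑ y ∈ T, PAF (x' y) 2 = -2 := by
    rw [Finset.sum_congr rfl fun y _ => PAF_translate (x y) (δ y) 2]; simpa using hgs 2 h20
  refine sum_family_qr37 x' hpm' h4' ?_
  rw [Finset.sum_add_distrib, Finset.sum_add_distrib, hgs1, hgs2, Finset.sum_const, hT18]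
  norm_num

/-- **EXCLUSION (order 37, block-preserving normalisers do not act through the cubic classes).**  Same hypotheses; then **no power
`μ^k` is `≡ 8 (mod 37)`** (the multiplier group misses the index-3 subgroup `⟨8⟩` of order 12). -/
theorem hadamard668_order37_normalizer_not_index3_generator (hH : IsHadamardMatrix H) (hι : Fintype.card ι = 668)
    {π κ π' κ' : Equiv.Perm ι} {d e d' e' : ι → ℤ} (haut : IsSignedAut H π κ d e)
    (hπ : π ^ 37 = 1) (hκ : κ ^ 37 = 1) (hne : π ≠ 1 ∨ κ ≠ 1)
    (haut' : IsSignedAut H π' κ' d' e') {μ : ℕ} (hnπ : π' * π = π ^ μ * π') (hnκ : κ' * κ = κ ^ μ * κ')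
    {x₀ : ι} (hx₀ : π x₀ ≠ x₀) (hrow : π' x₀ ∈ orbFin π 37 x₀) (hcols : ∀ y, κ y ≠ y → κ' y ∈ orbFin κ 37 y)
    (k : ℕ) : (μ : ZMod 37) ^ k ≠ 8 := by
  have h10 : (1 : ZMod 37) ≠ 0 := by decide
  have h20 : (2 : ZMod 37) ≠ 0 := by decide
  have h40 : (4 : ZMod 37) ≠ 0 := by decide
  have h81 : (8 : ZMod 37) ≠ 1 := by decide
  intro hk8
  have h37 := hadamard668_fixedRows_37 hH hι π κ d e haut hπ hκ hne
  obtain ⟨u, T, x, hu, hTc, hpm, hgs, htw⟩ := normalizing_prime_main (by norm_num : Nat.Prime 37) (by decide : Odd 37)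
    hH haut hπ hκ hne haut' hnπ hnκ hx₀ hrow hcols
  have hsplit := Finset.card_filter_add_card_filter_not (s := (univ : Finset ι)) (fun y => κ y = y)
  rw [h37.2, Finset.card_univ, hι] at hsplit
  have hm : (univ.filter fun y => ¬ κ y = y).card = 666 := by omega
  have hm' : (univ.filter fun y => κ y ≠ y).card = 666 := hm
  rw [hm'] at hTc
  have hT18 : T.card = 18 := by omega
  rw [h37.2] at hgs
  rw [← hu] at hk8
  have hu1 : (u : ZMod 37) ≠ 1 := fun h => h81 (by rw [← hk8, h, one_pow])
  haveI : Fact (Nat.Prime 37) := ⟨by norm_num⟩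
  have hrec : ∀ y ∈ T, ∃ δ : ZMod 37, HInvariant (Literature.Combinatorics.Designs.LegendrePairs.translate (x y) δ) u :=
    fun y hy => exists_translate_hInvariant_prime (x y) u hu1 (htw y hy)
  choose! δ hδ using hrec
  set x' : ι → ZMod 37 → ℤ := fun y => Literature.Combinatorics.Designs.LegendrePairs.translate (x y) (δ y) with hx'
  have hpm' : ∀ y ∈ T, IsPM (x' y) := fun y hy r => hpm y hy _
  have h8' : ∀ y ∈ T, ∀ i, x' y (8 * i) = x' y i := by
    intro y hy
    have hpow : ∀ n : ℕ, ∀ i, x' y ((u : ZMod 37) ^ n * i) = x' y i := by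
      intro n; induction n with
      | zero => intro i; simp
      | succ n ih => intro i; rw [pow_succ, mul_assoc, ih]; exact hδ y hy i
    intro i; rw [← hk8]; exact hpow k i
  have hgs' : ∀ s : ZMod 37, s ≠ 0 → ∑ y ∈ T, PAF (x' y) s = -2 := by
    intro s hs
    rw [Finset.sum_congr rfl fun y _ => PAF_translate (x y) (δ y) s]; simpa using hgs s hs
  have hsum : ∑ y ∈ T, (PAF (x' y) 1 + PAF (x' y) 2 + PAF (x' y) 4) = -6 := by
    rw [Finset.sum_add_distrib, Finset.sum_add_distrib, hgs' 1 h10, hgs' 2 h20, hgs' 4 h40]; norm_num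
  have hge : ∑ y ∈ T, (7 : ℤ) ≤ ∑ y ∈ T, (PAF (x' y) 1 + PAF (x' y) 2 + PAF (x' y) 4) :=
    Finset.sum_le_sum fun y hy => paf_124_of_inv8_37 (x' y) (hpm' y hy) (h8' y hy)
  rw [hsum, Finset.sum_const, hT18] at hge
  norm_num at hge

end main

end Summit.Ventures.DiscreteObjects.Hadamard
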